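import Literature.NumberTheory.EllipticCurves.IwasawaCoinvariantsRankProofs
import HarnessLib

/-!
# The `p`-power torsion of a restriction kernel is finite: a Kummer-theoretic skeleton
# (Greenberg, LNM 1716, §3, proof of Lemma 3.4, in `E(K̄_v)`-coefficients)

Sibling proof file (theorems only: **no definition and no named fact is introduced**) of
`Literature.NumberTheory.EllipticCurves.IwasawaSelmerControl` /
`Literature.NumberTheory.EllipticCurves.SelmerCorankControl`, in the generic style of
`Literature.NumberTheory.EllipticCurves.ResKernel` (`IwasawaCoinvariantsRankProofs`,
`IwasawaSelmerControlLocalInputsProofs`). It isolates the cohomological algebra of the one local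
input still missing for the `K = ℚ` case of Mazur's control theorem
(`Literature.NumberTheory.EllipticCurves.Greenberg1999_coinvariantsRank_eq_selmerCorank_rat_of_ordinary_local_finiteness`,
file `IwasawaSelmerControlAwayFromPProofs`): Greenberg's Lemma 3.4 at the layer `n = 0` — for
`E/ℚ_p` with good ordinary reduction, the `p`-power torsion of
`𝒦 = ker (H¹(ℚ_p, E) → H¹(ℚ_{p,∞}, E))` is finite (R. Greenberg, *Iwasawa theory for elliptic
curves*, LNM 1716 (1999), §3, Lemma 3.4, p. 89 of the held copy
`book:coates1999-arithmetic-theory-elliptic-curves`: "`#ker(r_{v_n}) = #Ẽ(f_{v_n})_p²` … It is finite").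

## The statement (`ResKernel.finite_primary_subgroupResKer_of_reduction`)

Let `G` be a topological group, `N ⊴ G` a normal subgroup and `γ ∈ G` such that `N` and `γ`
generate `G` topologically; let `A` ("`E(K̄_v)`") and `Ā` ("`Ẽ(k̄_v)`") be discrete `G`-modules with
continuous orbit maps and `red : A → Ā` ("reduction") an equivariant surjection with kernel `A₁`
("`E₁`, the formal group"); let `p` be a prime. Assume
* (div) `A` is `p`-divisible and (div₁) so is `A₁`; (tor) `Ā` is a torsion group;
* (fin) `Ā^N` is finite ("`Ẽ(k_∞) = Ẽ(𝔽_p)`: `ℚ_{p,∞}/ℚ_p` is totally ramified");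
* (C1) for every `k`, the continuous cocycles `G → C_k = A₁ ∩ A[p^k]` fall into at most `c₀ · p^k`
  classes modulo coboundaries of `p^k`-torsion elements ("`#H¹(ℚ_p, C[p^k]) ≤ c₀ p^k`": the
  local cohomology of the formal-group torsion `C = Ê[p^∞] ≅ ℚ_p/ℤ_p(χφ⁻¹)` has corank `≤ 1`);
* (C2) there is a `G`-fixed `u₁ ∈ A₁` ("a point of infinite order of `Ê(pℤ_p)`") with
  `n u₁ ∈ p^m A^G ⇒ p^m ∣ c₁ n` ("`Ê(pℤ_p) ≅ ℤ_p` up to finite index").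
Then the `p`-power torsion of `ker (res : H¹(G, A) → H¹(N, A))` is finite.

## The argument (elementary; no local duality, no universal norms)

Greenberg proves Lemma 3.4 from Props. 2.2, 2.4 (Coates–Greenberg: the image of the local Kummer
map over `(F_n)_{v_n}` and over the deeply ramified `(F_∞)_η`) and Poitou–Tate duality
(`H²(M, C_v) = 0`), reading the kernel off diagram (5), p. 89. For the FINITENESS (all that the
control theorem at `n = 0` needs) the same diagram can be run with upper bounds only:
1. (*torsion coefficients*) a class `x` of `H¹(G, A)` with `p^k x = 0` is represented by an
   `A[p^k]`-valued cocycle `ψ` (`A` is `p`-divisible: `p^k φ = ∂v`, `v = p^k b`, `ψ = φ - ∂b`);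
2. (*the quotient `D = Ẽ`*, Greenberg's `ker(d_{v_n})`) `red_* : ker res_A → ker res_Ā`, and
   `ker (H¹(G, Ā) → H¹(N, Ā)) ↪ Ā^N/(γ - 1)Ā^N` (`ResKernel.finite_subgroupResKer`) is finite by (fin);
3. (*the sub `C = Ê[p^∞]`*) if moreover `red_* x = 0`, then `red ∘ ψ = ∂ā` with `ā ∈ Ā[p^∞]`
   (drop the prime-to-`p` part of the torsion element `ā`), `ā = red t` with `t ∈ A[p^∞]` (by
   (div₁) and surjectivity), and `ψ - ∂t` takes values in `C_m = A₁ ∩ A[p^m]`;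
4. (*Kummer classes die in `H¹(G, A)`*, Greenberg's `Im κ ⊆ ker`) for `b ∈ A₁` with
   `p^m b = n u₁` the coboundaries `∂b` are `C_m`-valued cocycles with trivial class in `H¹(G, A)`,
   pairwise inequivalent modulo `∂(A[p^m])` for `0 ≤ n < p^m/c₁` by (C2); so each class of
   `H¹(G, A)` represented by a `C_m`-valued cocycle accounts for `≥ p^m/c₁` of the `≤ c₀ p^m`
   classes of (C1): there are at most `c₀ c₁` of them, uniformly in `m`;
5. an increasing union of sets of size `≤ c₀ c₁` is finite, and a group with finite image and
   finite kernel under `red_*` is finite.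
The arithmetic inputs (fin), (C1), (C2), (div₁) for `E/ℚ_p` good ordinary and the cyclotomic
tower are supplied by sibling files; this file is pure topological-group cohomology.

## References

* [GreenbergLNM1716] R. Greenberg, *Iwasawa theory for elliptic curves*, LNM 1716 (1999), §3,
  Lemma 3.4 and its proof (p. 89, diagram (5)); §2, Props. 2.2, 2.4 (pp. 72–75).
* J.-P. Serre, *Galois Cohomology* (1997), I.§2.6 (inflation–restriction), I.§5.1, II.§1.
* [SilvermanAEC2009] J. H. Silverman, *The Arithmetic of Elliptic Curves*, 2nd ed., VIII.§2
  (the Kummer sequence for `E`).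
-/

noncomputable section

open scoped Classical

universe u

namespace Literature.NumberTheory.EllipticCurves.ResKernel

open Literature.NumberTheory.GaloisRepresentations

variable {G : Type u} [Group G] [TopologicalSpace G] [IsTopologicalGroup G]
variable {A : Type u} [AddCommGroup A] [DistribMulAction G A] [TopologicalSpace A]
  [DiscreteTopology A]
variable {Ā : Type u} [AddCommGroup Ā] [DistribMulAction G Ā] [TopologicalSpace Ā]
  [DiscreteTopology Ā]

/-! ## Elementary divisibility bookkeeping -/

omit [TopologicalSpace G] [IsTopologicalGroup G] [TopologicalSpace A] [DiscreteTopology A] in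
/-- Iterated `p`-divisibility: if every element is `p • b`, every element is `p ^ k • b`. [folklore] -/
theorem exists_pow_smul_eq_of_forall_exists_smul_eq (p : ℕ) (hdiv : ∀ a : A, ∃ b : A, p • b = a)
    (k : ℕ) (a : A) : ∃ b : A, p ^ k • b = a := by
  induction k generalizing a with
  | zero => exact ⟨a, by rw [pow_zero, one_smul]⟩
  | succ k ih =>
    obtain ⟨b, rfl⟩ := hdiv a
    obtain ⟨c, rfl⟩ := ih b
    exact ⟨c, by rw [pow_succ, mul_comm, mul_smul]⟩

omit [TopologicalSpace G] [IsTopologicalGroup G] [TopologicalSpace A] [DiscreteTopology A]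
  [DistribMulAction G A] in
/-- Iterated `p`-divisibility inside the kernel of an additive map. [folklore] -/
theorem exists_pow_smul_eq_of_forall_exists_smul_eq_of_ker {B : Type*} [AddCommGroup B]
    (red : A →+ B) (p : ℕ)
    (hdiv₁ : ∀ a : A, red a = 0 → ∃ b : A, red b = 0 ∧ p • b = a) (k : ℕ) (a : A)
    (ha : red a = 0) : ∃ b : A, red b = 0 ∧ p ^ k • b = a := by
  induction k generalizing a with
  | zero => exact ⟨a, ha, by rw [pow_zero, one_smul]⟩
  | succ k ih =>
    obtain ⟨b, hb, rfl⟩ := hdiv₁ a ha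
    obtain ⟨c, hc, rfl⟩ := ih b hb
    exact ⟨c, hc, by rw [pow_succ, mul_comm, mul_smul]⟩

/-! ## Torsion classes are represented by torsion-valued cocycles (`A` divisible) -/

omit [IsTopologicalGroup G] in
/-- Values of an integer multiple of a cocycle. [folklore] -/
theorem coe_zsmul_cocycle_apply (n : ℤ) (φ : contOneCocycles (discreteTopRep G A)) (g : G) :
    (n • φ).1 g = n • φ.1 g := by
  rw [Submodule.coe_smul, ContinuousMap.smul_apply]

/-- **A `p^k`-torsion class of `H¹(G, A)` is represented by an `A[p^k]`-valued cocycle** when `A`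
is `p`-divisible: if `p^k [φ] = 0` then `p^k φ = ∂v`; writing `v = p^k b`, the cohomologous
cocycle `ψ = φ - ∂b` satisfies `p^k ψ = 0` pointwise. This is the surjectivity of
`H¹(M, E[p^k]) → H¹(M, E)[p^k]` in the Kummer sequence (Silverman, *AEC*, VIII.§2; Greenberg,
LNM 1716, §2 p. 71: "`H¹(M, E[p^∞])/Im κ ≅ H¹(M, E(F̄_v))_p`").
[cite: GreenbergLNM1716, §2 (p. 71)] [cite: SilvermanAEC2009, VIII.§2] -/
theorem exists_cocycle_nsmul_eq_zero_of_nsmul_class_eq_zero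
    (hcont : ∀ a : A, Continuous fun g : G ↦ g • a) (p : ℕ)
    (hdiv : ∀ a : A, ∃ b : A, p • b = a) {k : ℕ} {x : discreteH1 G A} (hx : p ^ k • x = 0) :
    ∃ ψ : contOneCocycles (discreteTopRep G A),
      oneCocycleClass _ ψ = x ∧ ∀ g, p ^ k • ψ.1 g = 0 := by
  obtain ⟨φ, rfl⟩ := oneCocycleClass_surjective _ x
  have h0 : oneCocycleClass _ (((p ^ k : ℕ) : ℤ) • φ) = 0 := by
    rw [oneCocycleClass_smul, Nat.cast_smul_eq_nsmul, hx]
  obtain ⟨v, hv⟩ := (oneCocycleClass_eq_zero_iff _ _).mp h0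
  obtain ⟨b, rfl⟩ := exists_pow_smul_eq_of_forall_exists_smul_eq p hdiv k v
  refine ⟨φ - cobCocycle b (hcont b), ?_, fun g ↦ ?_⟩
  · rw [oneCocycleClass_sub, oneCocycleClass_cobCocycle, sub_zero]
  · have h := hv g
    rw [coe_zsmul_cocycle_apply, Nat.cast_smul_eq_nsmul] at h
    rw [Submodule.coe_sub, ContinuousMap.sub_apply, cobCocycle_apply, smul_sub, h, smul_sub,
      smul_comm]
    exact sub_self _

/-! ## Pushing classes forward along an equivariant map `red : A → Ā` -/

section Pushforward

variable (red : A →+ Ā) (hred : ∀ (g : G) (a : A), red (g • a) = g • red a)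

omit [TopologicalSpace A] [DiscreteTopology A] [TopologicalSpace Ā] [DiscreteTopology Ā]
  [IsTopologicalGroup G] in
include hred in
/-- The compatibility hypothesis of `resH1Hom` for the pair `(id_G, red)`. [folklore] -/
theorem compat_id_of_equivariant :
    ∀ (x : G) (m : A), red ((ContinuousMonoidHom.id G) x • m) = x • red m :=
  fun x m ↦ hred x m

/-- `red_* [φ] = [red ∘ φ]` on explicit cocycles (Mathlib's `map_oneCocycleClass`).
Serre, *Galois Cohomology*, I.§2.4. [folklore] -/
theorem resH1Hom_id_oneCocycleClass (φ : contOneCocycles (discreteTopRep G A)) :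
    resH1Hom (ContinuousMonoidHom.id G) red (compat_id_of_equivariant red hred)
        (oneCocycleClass _ φ) =
      oneCocycleClass (discreteTopRep G Ā) (contOneCocycles.pullback (ContinuousMonoidHom.id G)
        (resHomOfEquivariant (ContinuousMonoidHom.id G) red (compat_id_of_equivariant red hred))
          φ) :=
  map_oneCocycleClass (X := discreteTopRep G A) (Y := discreteTopRep G Ā) _ _ φ

omit [IsTopologicalGroup G] in
/-- Values of the pushed-forward cocycle: `(red ∘ φ)(g) = red (φ g)`. [folklore] -/
theorem pullback_id_apply (φ : contOneCocycles (discreteTopRep G A)) (g : G) :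
    (contOneCocycles.pullback (ContinuousMonoidHom.id G)
        (resHomOfEquivariant (ContinuousMonoidHom.id G) red (compat_id_of_equivariant red hred))
          φ).1 g = red (φ.1 g) :=
  rfl

/-- **`red_*` maps `ker res_A` into `ker res_Ā`** (naturality of restriction to `N`,
`resH1Hom_comp_resSubgroup`). Serre, *Galois Cohomology*, I.§2.4–2.5. [folklore] -/
theorem resH1Hom_id_mem_subgroupResKer (N : Subgroup G) {x : discreteH1 G A}
    (hx : x ∈ subgroupResKer A N) :
    resH1Hom (ContinuousMonoidHom.id G) red (compat_id_of_equivariant red hred) x ∈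
      subgroupResKer Ā N := by
  have hnat := resH1Hom_comp_resSubgroup (ContinuousMonoidHom.id G) red
    (compat_id_of_equivariant red hred) N N (ContinuousMonoidHom.id N) (fun _ ↦ rfl)
    (fun x m ↦ hred x m)
  have h := congrArg (fun f ↦ f x) hnat
  simp only [AddMonoidHom.coe_comp, Function.comp_apply] at h
  rw [mem_subgroupResKer_iff] at hx ⊢
  rw [← h, hx, map_zero]

end Pushforward

/-! ## Step 3: classes killed by `red_*` come from `C = A₁[p^∞]`-valued cocycles -/

omit [TopologicalSpace G] [IsTopologicalGroup G] [TopologicalSpace Ā] [DiscreteTopology Ā] in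
/-- **Dropping the prime-to-`p` part of a torsion element without changing its coboundary.** If
`ā` has finite order and all `g • ā - ā` are killed by `p ^ k`, then some multiple `ā₁` of `ā` is
killed by a power of `p` and has the same coboundary: with `ord ā = p^j m`, `p ∤ m`,
`α m + β p^{k+j} = 1`, take `ā₁ = α m ā`. [folklore] -/
theorem exists_psmul_eq_zero_and_coboundary_eq (p : ℕ) [hp : Fact p.Prime] {k : ℕ} {ā : Ā}
    (hā : IsOfFinAddOrder ā) (hk : ∀ g : G, p ^ k • (g • ā - ā) = 0) :
    ∃ (ā₁ : Ā) (j : ℕ), p ^ j • ā₁ = 0 ∧ ∀ g : G, g • ā₁ - ā₁ = g • ā - ā := by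
  have ho : addOrderOf ā ≠ 0 := hā.addOrderOf_pos.ne'
  obtain ⟨j, m, hm, hjm⟩ := Nat.exists_eq_pow_mul_and_not_dvd ho p hp.out.one_lt.ne'
  have hcop : IsCoprime (m : ℤ) ((p : ℤ) ^ (k + j)) := by
    rw [← Nat.cast_pow, Nat.isCoprime_iff_coprime]
    exact (Nat.Coprime.pow_right _ ((Nat.Prime.coprime_iff_not_dvd hp.out).mpr hm).symm)
  obtain ⟨α, β, hαβ⟩ := hcop
  refine ⟨(α * m) • ā, j, ?_, fun g ↦ ?_⟩
  · rw [← natCast_zsmul, smul_smul, show ((p ^ j : ℕ) : ℤ) * (α * m) = α * (p ^ j * m : ℕ) by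
      push_cast; ring, ← smul_smul, natCast_zsmul, ← hjm, addOrderOf_nsmul_eq_zero, smul_zero]
  · have h1 : g • ā - ā = (α * m) • (g • ā - ā) + β • ((p : ℤ) ^ (k + j) • (g • ā - ā)) := by
      rw [smul_smul, ← add_smul, hαβ, one_smul]
    have h2 : (p : ℤ) ^ (k + j) • (g • ā - ā) = 0 := by
      rw [← Nat.cast_pow, natCast_zsmul, pow_add, mul_comm, mul_smul, hk g, smul_zero]
    rw [h2, smul_zero, add_zero] at h1
    rw [h1, smul_sub, smul_comm]

omit [TopologicalSpace G] [IsTopologicalGroup G] [TopologicalSpace A] [DiscreteTopology A]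
  [TopologicalSpace Ā] [DiscreteTopology Ā] [DistribMulAction G A] [DistribMulAction G Ā] in
/-- **Lifting `p`-power torsion along `red`.** If `red : A → Ā` is onto and `A₁ = ker red` is
`p`-divisible, an element `ā ∈ Ā` with `p ^ j • ā = 0` lifts to `t ∈ A` with `p ^ j • t = 0`
("`E[p^∞] → Ẽ[p^∞]` is onto", the reduction sequence `0 → C → E[p^∞] → Ẽ[p^∞] → 0` of
Greenberg, LNM 1716, proof of Lemma 3.4, p. 89). [cite: GreenbergLNM1716, §3 Lemma 3.4 (proof)] -/
theorem exists_lift_nsmul_eq_zero (red : A →+ Ā) (hsurj : Function.Surjective red) (p : ℕ)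
    (hdiv₁ : ∀ a : A, red a = 0 → ∃ b : A, red b = 0 ∧ p • b = a) {j : ℕ} {ā : Ā}
    (hā : p ^ j • ā = 0) : ∃ t : A, red t = ā ∧ p ^ j • t = 0 := by
  obtain ⟨a₀, rfl⟩ := hsurj ā
  obtain ⟨b₁, hb₁, hpb⟩ := exists_pow_smul_eq_of_forall_exists_smul_eq_of_ker red p hdiv₁ j
    (p ^ j • a₀) (by rw [map_nsmul, hā])
  exact ⟨a₀ - b₁, by rw [map_sub, hb₁, sub_zero], by rw [smul_sub, hpb, sub_self]⟩

omit [TopologicalSpace Ā] [DiscreteTopology Ā] in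
/-- **Step 3.** Let `ψ` be an `A[p^k]`-valued cocycle whose push-forward `red ∘ ψ` is a coboundary
in `Ā`. Then `ψ` is cohomologous in `A` to a cocycle with values in `C_m = A₁ ∩ A[p^m]` for some
`m`: `red ∘ ψ = ∂ā` with `ā` torsion; replace `ā` by its `p`-part `ā₁` (same coboundary), lift
`ā₁ = red t` with `t ∈ A[p^j]`, and take `ψ - ∂t`. This is the exactness of
`H¹(G, C) → H¹(G, E[p^∞]) → H¹(G, Ẽ[p^∞])` in Greenberg's diagram (5) (LNM 1716, p. 89), in
`E(K̄_v)`-coefficients. [cite: GreenbergLNM1716, §3 Lemma 3.4 (proof, diagram (5))] -/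
theorem exists_cocycle_ker_valued (hcont : ∀ a : A, Continuous fun g : G ↦ g • a)
    (red : A →+ Ā) (hred : ∀ (g : G) (a : A), red (g • a) = g • red a)
    (hsurj : Function.Surjective red) (p : ℕ) [Fact p.Prime]
    (hdiv₁ : ∀ a : A, red a = 0 → ∃ b : A, red b = 0 ∧ p • b = a)
    (htor : ∀ ā : Ā, IsOfFinAddOrder ā)
    {k : ℕ} (ψ : contOneCocycles (discreteTopRep G A)) (hψ : ∀ g, p ^ k • ψ.1 g = 0)
    {ā : Ā} (hā : ∀ g, red (ψ.1 g) = g • ā - ā) :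
    ∃ (m : ℕ) (ψ' : contOneCocycles (discreteTopRep G A)),
      oneCocycleClass _ ψ' = oneCocycleClass _ ψ ∧
        (∀ g, p ^ m • ψ'.1 g = 0) ∧ ∀ g, red (ψ'.1 g) = 0 := by
  have hk : ∀ g : G, p ^ k • (g • ā - ā) = 0 := fun g ↦ by
    rw [← hā g, ← map_nsmul, hψ g, map_zero]
  obtain ⟨ā₁, j, hj, hcob⟩ := exists_psmul_eq_zero_and_coboundary_eq (G := G) p (htor ā) hk
  obtain ⟨t, hrt, hpt⟩ := exists_lift_nsmul_eq_zero red hsurj p hdiv₁ hj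
  refine ⟨k + j, ψ - cobCocycle t (hcont t), ?_, fun g ↦ ?_, fun g ↦ ?_⟩
  · rw [oneCocycleClass_sub, oneCocycleClass_cobCocycle, sub_zero]
  · have h1 : p ^ (k + j) • ψ.1 g = 0 := by
      rw [pow_add, mul_comm, mul_smul, hψ g, smul_zero]
    have h2 : p ^ (k + j) • (g • t - t) = 0 := by
      rw [pow_add, mul_smul, smul_sub (p ^ j), smul_comm (p ^ j) g t, hpt, smul_zero, sub_self,
        smul_zero]
    rw [Submodule.coe_sub, ContinuousMap.sub_apply, cobCocycle_apply, smul_sub, h1, h2, sub_self]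
  · rw [Submodule.coe_sub, ContinuousMap.sub_apply, cobCocycle_apply, map_sub, map_sub, hred, hrt,
      hā g, hcob g, sub_self]

/-! ## Step 4: counting the classes of `C_m`-valued cocycles in `H¹(G, A)` -/

omit [TopologicalSpace G] [IsTopologicalGroup G] [TopologicalSpace A] [DiscreteTopology A]
  [DistribMulAction G A] [AddCommGroup A] in
/-- Bookkeeping for `M = ⌈p^m / c₁⌉ = (p^m - 1)/c₁ + 1`: `p^m ≤ c₁ M` and `c₁ (M - 1) < p^m`.
[folklore] -/
theorem pow_le_mul_ceilDiv_and_lt (p c₁ m : ℕ) (hp : 0 < p) (hc₁ : 0 < c₁) :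
    p ^ m ≤ c₁ * ((p ^ m - 1) / c₁ + 1) ∧ c₁ * ((p ^ m - 1) / c₁) < p ^ m := by
  have h1 : 1 ≤ p ^ m := Nat.one_le_pow m p hp
  constructor
  · have h := Nat.lt_div_mul_add (a := p ^ m - 1) hc₁
    rw [mul_add, mul_one, mul_comm]
    omega
  · have h := Nat.div_mul_le_self (p ^ m - 1) c₁
    rw [mul_comm]
    omega

omit [TopologicalSpace Ā] [DiscreteTopology Ā] in
/-- **Step 4: at most `c₀ c₁` classes of `H¹(G, A)` are represented by `C_m`-valued cocycles.**
Let `S` be a set of `≤ c₀ p^m` cocycles representing every `C_m = A₁ ∩ A[p^m]`-valued cocycle up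
to the coboundary of a `p^m`-torsion element ((C1): "`#H¹(G, C_m) ≤ c₀ p^m`"), and let `u₁ ∈ A₁^G`
satisfy `n u₁ ∈ p^m A^G ⇒ p^m ∣ c₁ n` ((C2)). For `b_n ∈ A₁` with `p^m b_n = n u₁`
(`0 ≤ n < M = ⌈p^m/c₁⌉`) and a `C_m`-valued cocycle `ψ`, the cocycles `ψ + ∂b_n` are again
`C_m`-valued, have the class of `ψ` in `H¹(G, A)`, and have pairwise distinct representatives in
`S`: equal representatives give `∂(b_n - b_{n'}) = ∂t` with `p^m t = 0`, so
`(n - n') u₁ = p^m (b_n - b_{n'} - t) ∈ p^m A^G` and `p^m ∣ c₁ (n - n')`, `|n - n'| < M`. Hence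
`#F · M ≤ #S ≤ c₀ p^m ≤ c₀ c₁ M` for every finite set `F` of such classes. This is the finiteness of
`Im(λ)/Im(κ)` ("`Im κ_{v_n} = Im(λ_{v_n})_div`", Greenberg, LNM 1716, Prop. 2.2 and proof of
Lemma 3.4, p. 89), obtained by counting instead of by coranks.
[cite: GreenbergLNM1716, §3 Lemma 3.4 (proof), §2 Prop. 2.2] -/
theorem card_le_of_forall_exists_kerValued_cocycle
    (hcont : ∀ a : A, Continuous fun g : G ↦ g • a) (red : A →+ Ā)
    (hred : ∀ (g : G) (a : A), red (g • a) = g • red a) (p : ℕ) [hp : Fact p.Prime]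
    (hdiv₁ : ∀ a : A, red a = 0 → ∃ b : A, red b = 0 ∧ p • b = a)
    {c₀ : ℕ} {m : ℕ} (S : Finset (contOneCocycles (discreteTopRep G A)))
    (hS : S.card ≤ c₀ * p ^ m)
    (hrep : ∀ ψ : contOneCocycles (discreteTopRep G A), (∀ g, p ^ m • ψ.1 g = 0) →
      (∀ g, red (ψ.1 g) = 0) →
        ∃ ψ₀ ∈ S, ∃ t : A, p ^ m • t = 0 ∧ ∀ g, ψ.1 g - ψ₀.1 g = g • t - t)
    {u₁ : A} (hu₁G : ∀ g : G, g • u₁ = u₁) (hu₁ : red u₁ = 0) {c₁ : ℕ} (hc₁ : 0 < c₁)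
    (hC2 : ∀ (n : ℤ) (a : A), (∀ g : G, g • a = a) → n • u₁ = p ^ m • a →
      ((p ^ m : ℕ) : ℤ) ∣ c₁ * n)
    (F : Finset (discreteH1 G A))
    (hF : ∀ x ∈ F, ∃ ψ : contOneCocycles (discreteTopRep G A),
      oneCocycleClass _ ψ = x ∧ (∀ g, p ^ m • ψ.1 g = 0) ∧ ∀ g, red (ψ.1 g) = 0) :
    F.card ≤ c₀ * c₁ := by
  set M : ℕ := (p ^ m - 1) / c₁ + 1 with hMdef
  obtain ⟨hpM, hcM⟩ := pow_le_mul_ceilDiv_and_lt p c₁ m hp.out.pos hc₁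
  have hM0 : 0 < M := Nat.succ_pos _
  -- the Kummer elements `b_n ∈ A₁`, `p^m b_n = n u₁`
  have hb : ∀ n : ℕ, ∃ b : A, red b = 0 ∧ p ^ m • b = n • u₁ := fun n ↦
    exists_pow_smul_eq_of_forall_exists_smul_eq_of_ker red p hdiv₁ m (n • u₁)
      (by rw [map_nsmul, hu₁, smul_zero])
  choose b hb0 hbu using hb
  -- representatives of the classes in `F`
  choose ψ hψx hψp hψr using hF
  -- the translated cocycles `ψ_x + ∂b_n` and their representatives in `S`
  have hθ : ∀ (x : discreteH1 G A) (hx : x ∈ F) (n : ℕ), ∃ ψ₀ ∈ S, ∃ t : A, p ^ m • t = 0 ∧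
      ∀ g, (ψ x hx).1 g + (g • b n - b n) - ψ₀.1 g = g • t - t := by
    intro x hx n
    obtain ⟨ψ₀, hψ₀, t, ht, hdiff⟩ := hrep (ψ x hx + cobCocycle (b n) (hcont _))
      (fun g ↦ by
        rw [Submodule.coe_add, ContinuousMap.add_apply, cobCocycle_apply, smul_add, hψp x hx g,
          zero_add, smul_sub, smul_comm (p ^ m) g (b n), hbu n, smul_comm g n u₁, hu₁G g,
          sub_self])
      (fun g ↦ by
        rw [Submodule.coe_add, ContinuousMap.add_apply, cobCocycle_apply, map_add, hψr x hx g,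
          zero_add, map_sub, hred, hb0 n, smul_zero, sub_self])
    exact ⟨ψ₀, hψ₀, t, ht, fun g ↦ by
      have := hdiff g
      rwa [Submodule.coe_add, ContinuousMap.add_apply, cobCocycle_apply] at this⟩
  choose ρ hρS t ht hρ using hθ
  -- every class in `F` is the class of each of its representatives `ρ x n`
  have hclass : ∀ (x : discreteH1 G A) (hx : x ∈ F) (n : ℕ),
      oneCocycleClass _ (ρ x hx n) = x := by
    intro x hx n
    refine Eq.trans ?_ (hψx x hx)
    rw [← sub_eq_zero, ← oneCocycleClass_sub, oneCocycleClass_eq_zero_iff]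
    refine ⟨b n - t x hx n, fun g ↦ ?_⟩
    change (ρ x hx n).1 g - (ψ x hx).1 g = g • (b n - t x hx n) - (b n - t x hx n)
    have h := hρ x hx n g
    rw [← sub_eq_zero]
    have e : (ρ x hx n).1 g - (ψ x hx).1 g - (g • (b n - t x hx n) - (b n - t x hx n)) =
        (g • t x hx n - t x hx n) -
          ((ψ x hx).1 g + (g • b n - b n) - (ρ x hx n).1 g) := by
      rw [smul_sub]; abel
    rw [e, h, sub_self]
  -- the map `(x, n) ↦ ρ x n` is injective on `F × [0, M)`
  let f : discreteH1 G A × ℕ → contOneCocycles (discreteTopRep G A) := fun q ↦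
    if h : q.1 ∈ F then ρ q.1 h q.2 else 0
  have hfS : ∀ q ∈ F ×ˢ Finset.range M, f q ∈ S := by
    intro q hq
    rw [Finset.mem_product] at hq
    simp only [f, dif_pos hq.1]
    exact hρS _ _ _
  have hinj : Set.InjOn f ↑(F ×ˢ Finset.range M) := by
    rintro ⟨x, n⟩ hq ⟨x', n'⟩ hq' hff
    rw [Finset.coe_product, Set.mem_prod, Finset.mem_coe, Finset.mem_coe, Finset.mem_range] at hq hq'
    obtain ⟨hx, hn⟩ := hq
    obtain ⟨hx', hn'⟩ := hq'
    simp only [f, dif_pos hx, dif_pos hx'] at hff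
    -- same class, so `x = x'`
    have hxx : x = x' := by rw [← hclass x hx n, ← hclass x' hx' n', hff]
    subst hxx
    -- equal representatives for `n` and `n'` force `p^m ∣ c₁ (n - n')`
    have hfix : ∀ g : G, g • (b n - b n' - (t x hx n - t x hx n')) =
        b n - b n' - (t x hx n - t x hx n') := by
      intro g
      have h1 := hρ x hx n g
      have h2 := hρ x hx n' g
      rw [hff] at h1
      rw [← sub_eq_zero]
      have e : g • (b n - b n' - (t x hx n - t x hx n')) - (b n - b n' - (t x hx n - t x hx n')) =
          ((ψ x hx).1 g + (g • b n - b n) - (ρ x hx n').1 g - (g • t x hx n - t x hx n)) -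
            ((ψ x hx).1 g + (g • b n' - b n') - (ρ x hx n').1 g -
              (g • t x hx n' - t x hx n')) := by
        rw [smul_sub, smul_sub, smul_sub]; abel
      rw [e, h1, h2, sub_self, sub_self, sub_self]
    have hsmul : ((n : ℤ) - n') • u₁ = p ^ m • (b n - b n' - (t x hx n - t x hx n')) := by
      rw [smul_sub, smul_sub, smul_sub, hbu n, hbu n', ht x hx n, ht x hx n', sub_self, sub_zero,
        sub_smul, natCast_zsmul, natCast_zsmul]
    have hdvd := hC2 _ _ hfix hsmul
    -- `|c₁ (n - n')| < p^m`, so `n = n'`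
    have habs : (c₁ * ((n : ℤ) - n')).natAbs < p ^ m := by
      rw [Int.natAbs_mul, Int.natAbs_natCast]
      have h1 : ((n : ℤ) - n').natAbs ≤ M - 1 := by omega
      calc c₁ * ((n : ℤ) - n').natAbs ≤ c₁ * (M - 1) := Nat.mul_le_mul_left _ h1
        _ = c₁ * ((p ^ m - 1) / c₁) := by rw [hMdef, Nat.add_sub_cancel]
        _ < p ^ m := hcM
    have hzero := Nat.eq_zero_of_dvd_of_lt (Int.natCast_dvd.mp hdvd) habs
    rw [Int.natAbs_mul, Int.natAbs_natCast, mul_eq_zero] at hzero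
    rcases hzero with h0 | h0
    · exact absurd h0 hc₁.ne'
    · have : n = n' := by omega
      subst this
      rfl
  have hcard := Finset.card_le_card_of_injOn f hfS hinj
  rw [Finset.card_product, Finset.card_range] at hcard
  have h : F.card * M ≤ c₀ * c₁ * M :=
    hcard.trans (hS.trans ((Nat.mul_le_mul_left c₀ hpM).trans_eq (by ring)))
  exact Nat.le_of_mul_le_mul_right h hM0

/-! ## Assembly -/

omit [TopologicalSpace G] [IsTopologicalGroup G] [TopologicalSpace A] [DiscreteTopology A]
  [DistribMulAction G A] [AddCommGroup A] in
/-- An increasing family of sets whose finite subsets have bounded size has a union whose finite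
subsets have bounded size. [folklore] -/
theorem card_le_of_subset_iUnion_mono {X : Type*} (T : ℕ → Set X)
    (hmono : ∀ m m', m ≤ m' → T m ⊆ T m') {B : ℕ}
    (hB : ∀ (m : ℕ) (F : Finset X), ↑F ⊆ T m → F.card ≤ B) (F : Finset X)
    (hF : ∀ x ∈ F, ∃ m, x ∈ T m) : F.card ≤ B := by
  choose μ hμ using hF
  refine hB (F.attach.sup fun x ↦ μ x.1 x.2) F fun x hx ↦ ?_
  exact hmono _ _ (Finset.le_sup (f := fun x : {x // x ∈ F} ↦ μ x.1 x.2) (Finset.mem_attach F ⟨x, hx⟩))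
    (hμ x hx)

set_option maxHeartbeats 800000 in
/-- **The `p`-power torsion of the restriction kernel `ker (H¹(G, A) → H¹(N, A))` is finite**, under
the hypotheses (div), (div₁), (tor), (fin), (C1), (C2) of the module docstring — the skeleton of
Greenberg's proof of Lemma 3.4 (LNM 1716, §3, p. 89: `ker(r_{v_n})` is finite for `v ∣ p` of good
ordinary reduction) with `A = E(K̄_v)`, `Ā = Ẽ(k̄_v)`, `red` the reduction map, `N = Gal(K̄_v/K_{∞,η})`
and `γ` a topological generator of `Gal(K_{∞,η}/K_v)`. Proof: `red_*` maps the kernel to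
`ker (H¹(G, Ā) → H¹(N, Ā))`, finite by `ResKernel.finite_subgroupResKer` and (fin); a `p`-power
torsion class killed by `red_*` is represented by a `C_m`-valued cocycle
(`exists_cocycle_nsmul_eq_zero_of_nsmul_class_eq_zero`, `exists_cocycle_ker_valued`), and there are
at most `c₀ c₁` such classes for each `m` (`card_le_of_forall_exists_kerValued_cocycle`), a bound
uniform in `m`; a group with finite image and boundedly many elements in each fibre is finite.
[cite: GreenbergLNM1716, §3 Lemma 3.4 (p. 89)] -/
theorem finite_primary_subgroupResKer_of_reduction (N : Subgroup G) [N.Normal] (γ : G)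
    (hgen : ∀ U : Subgroup G, IsOpen (U : Set G) → N ≤ U → γ ∈ U → U = ⊤)
    (hcont : ∀ a : A, Continuous fun g : G ↦ g • a)
    (hcontĀ : ∀ ā : Ā, Continuous fun g : G ↦ g • ā)
    (red : A →+ Ā) (hred : ∀ (g : G) (a : A), red (g • a) = g • red a)
    (hsurj : Function.Surjective red) (p : ℕ) [hp : Fact p.Prime]
    (hdiv : ∀ a : A, ∃ b : A, p • b = a)
    (hdiv₁ : ∀ a : A, red a = 0 → ∃ b : A, red b = 0 ∧ p • b = a)
    (htor : ∀ ā : Ā, IsOfFinAddOrder ā)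
    [Finite (FixedPoints.addSubgroup N Ā)]
    {c₀ : ℕ} (hC1 : ∀ k : ℕ, ∃ S : Finset (contOneCocycles (discreteTopRep G A)),
      S.card ≤ c₀ * p ^ k ∧ ∀ ψ : contOneCocycles (discreteTopRep G A),
        (∀ g, p ^ k • ψ.1 g = 0) → (∀ g, red (ψ.1 g) = 0) →
          ∃ ψ₀ ∈ S, ∃ t : A, p ^ k • t = 0 ∧ ∀ g, ψ.1 g - ψ₀.1 g = g • t - t)
    {u₁ : A} (hu₁G : ∀ g : G, g • u₁ = u₁) (hu₁ : red u₁ = 0) {c₁ : ℕ} (hc₁ : 0 < c₁)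
    (hC2 : ∀ (m : ℕ) (n : ℤ) (a : A), (∀ g : G, g • a = a) → n • u₁ = p ^ m • a →
      ((p ^ m : ℕ) : ℤ) ∣ c₁ * n) :
    Finite {x : subgroupResKer A N // ∃ k : ℕ, p ^ k • x = 0} := by
  -- the push-forward `Φ = red_*`
  let Φ : discreteH1 G A →+ discreteH1 G Ā :=
    resH1Hom (ContinuousMonoidHom.id G) red (compat_id_of_equivariant red hred)
  -- the sets `T m` of classes of `C_m`-valued cocycles
  let T : ℕ → Set (discreteH1 G A) := fun m ↦ {x | ∃ ψ : contOneCocycles (discreteTopRep G A),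
    oneCocycleClass _ ψ = x ∧ (∀ g, p ^ m • ψ.1 g = 0) ∧ ∀ g, red (ψ.1 g) = 0}
  have hmono : ∀ m m', m ≤ m' → T m ⊆ T m' := by
    rintro m m' hmm x ⟨ψ, hψx, hψp, hψr⟩
    refine ⟨ψ, hψx, fun g ↦ ?_, hψr⟩
    obtain ⟨d, rfl⟩ := Nat.exists_eq_add_of_le hmm
    rw [pow_add, mul_comm, mul_smul, hψp g, smul_zero]
  have hB : ∀ (m : ℕ) (F : Finset (discreteH1 G A)), ↑F ⊆ T m → F.card ≤ c₀ * c₁ := by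
    intro m F hF
    obtain ⟨S, hS, hrep⟩ := hC1 m
    exact card_le_of_forall_exists_kerValued_cocycle hcont red hred p hdiv₁ S hS hrep hu₁G hu₁ hc₁
      (hC2 m) F fun x hx ↦ hF hx
  -- `p`-power torsion classes killed by `Φ` lie in some `T m`
  have hker : ∀ x : discreteH1 G A, (∃ k, p ^ k • x = 0) → Φ x = 0 → ∃ m, x ∈ T m := by
    rintro x ⟨k, hk⟩ hΦ
    obtain ⟨ψ, rfl, hψp⟩ := exists_cocycle_nsmul_eq_zero_of_nsmul_class_eq_zero hcont p hdiv hk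
    have h0 : oneCocycleClass (discreteTopRep G Ā) (contOneCocycles.pullback (ContinuousMonoidHom.id G)
        (resHomOfEquivariant (ContinuousMonoidHom.id G) red (compat_id_of_equivariant red hred))
          ψ) = 0 := by
      rw [← resH1Hom_id_oneCocycleClass red hred ψ]; exact hΦ
    obtain ⟨ā, hā⟩ := (oneCocycleClass_eq_zero_iff _ _).mp h0
    obtain ⟨m, ψ', hψ', hψ'p, hψ'r⟩ := exists_cocycle_ker_valued hcont red hred hsurj p hdiv₁ htor
      ψ hψp (ā := ā) (fun g ↦ hā g)
    exact ⟨m, ψ', hψ', hψ'p, hψ'r⟩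
  -- hence finite sets of such classes have at most `c₀ c₁` elements
  have hkerF : ∀ F : Finset (discreteH1 G A),
      (∀ x ∈ F, (∃ k, p ^ k • x = 0) ∧ Φ x = 0) → F.card ≤ c₀ * c₁ := fun F hF ↦
    card_le_of_subset_iUnion_mono T hmono hB F fun x hx ↦ hker x (hF x hx).1 (hF x hx).2
  -- the target of `Φ` on the restriction kernel is finite
  haveI : Finite (FixedPoints.addSubgroup N Ā ⧸ (subOne N Ā γ).range) := inferInstance
  haveI hfinĀ : Finite (subgroupResKer Ā N) := (finite_subgroupResKer N Ā γ hgen hcontĀ).1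
  -- conclude by an infinite pigeonhole
  rw [← not_infinite_iff_finite]
  intro hinf
  let P := {x : subgroupResKer A N // ∃ k : ℕ, p ^ k • x = 0}
  let Φ' : P → subgroupResKer Ā N := fun x ↦
    ⟨Φ (x.1 : discreteH1 G A), resH1Hom_id_mem_subgroupResKer red hred N x.1.2⟩
  obtain ⟨y, hy⟩ := Finite.exists_infinite_fiber Φ'
  obtain ⟨x₀, hx₀⟩ := hy.nonempty
  obtain ⟨s, hs⟩ := Infinite.exists_subset_card_eq (Φ' ⁻¹' {y}) (c₀ * c₁ + 1)
  -- the differences `x - x₀`, `x ∈ s`, are `c₀ c₁ + 1` distinct torsion classes killed by `Φ`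
  let δ : (Φ' ⁻¹' {y}) → discreteH1 G A := fun x ↦ (x.1.1 : discreteH1 G A) - (x₀.1 : discreteH1 G A)
  have hδ : Function.Injective δ := by
    intro a b hab
    have h : (a.1.1 : discreteH1 G A) = b.1.1 := sub_left_injective hab
    exact Subtype.ext (Subtype.ext (Subtype.ext h))
  have hcard := hkerF (s.image δ) (by
    intro z hz
    obtain ⟨x, -, rfl⟩ := Finset.mem_image.mp hz
    constructor
    · obtain ⟨k, hk⟩ := x.1.2
      obtain ⟨k₀, hk₀⟩ := x₀.2
      refine ⟨k + k₀, ?_⟩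
      have hk' : p ^ k • (x.1.1 : discreteH1 G A) = 0 := by
        rw [← AddSubmonoidClass.coe_nsmul, hk, ZeroMemClass.coe_zero]
      have hk₀' : p ^ k₀ • (x₀.1 : discreteH1 G A) = 0 := by
        rw [← AddSubmonoidClass.coe_nsmul, hk₀, ZeroMemClass.coe_zero]
      change p ^ (k + k₀) • ((x.1.1 : discreteH1 G A) - (x₀.1 : discreteH1 G A)) = 0
      rw [smul_sub, pow_add, mul_smul, mul_smul, hk₀', smul_zero, sub_zero, smul_comm, hk',
        smul_zero]
    · have hx : Φ' x.1 = y := x.2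
      have h1 : Φ (x.1.1 : discreteH1 G A) = (y : discreteH1 G Ā) := congrArg Subtype.val hx
      have h2 : Φ (x₀.1 : discreteH1 G A) = (y : discreteH1 G Ā) := congrArg Subtype.val hx₀
      change Φ ((x.1.1 : discreteH1 G A) - (x₀.1 : discreteH1 G A)) = 0
      rw [map_sub, h1, h2, sub_self])
  rw [Finset.card_image_of_injective s hδ, hs] at hcard
  exact Nat.lt_irrefl _ hcard

end Literature.NumberTheory.EllipticCurves.ResKernel
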